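import Literature.Geometry.Lorentzian.StationaryOrbitProjection
import HarnessLib

/-!
# Vertical and horizontal subspaces of the orbit-space projection
(Anderson 2000, §0–§1.1: "the vertical subspace of `TM` is the subspace spanned by the Killing field
`X` and the horizontal distribution `𝓗` is its orthogonal complement")

M. T. Anderson, *On stationary vacuum solutions to the Einstein equations*, Ann. Henri Poincaré 1
(2000), §0: "The metric `g = g_M` restricted to the horizontal subspaces of `TM`, i.e. the
orthogonal complement of `⟨X⟩ ⊂ TM` then induces a Riemannian metric `g_S` on `S`"; §1.1: "The
vertical subspace of `TM` is the subspace spanned by the Killing field `X` and the horizontal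
distribution `𝓗` is its orthogonal complement in `TM`, defined by the metric `g_M`." For the smooth
orbit space `S = OrbitSpace X` of a chronological stationary space-time and its `C^∞` submersion
`π = orbitProj X` (`StationaryOrbitSpaceManifold.lean`, `StationaryOrbitProjection.lean`) this
file proves the linear algebra behind this sentence at every point `y`:

* `IsStationaryKilling.ker_mfderiv_orbitProj_eq_span` — **the vertical subspace is `ker dπ_y = ℝ·X y`**
  (`dπ(X) = 0`, `mfderiv_orbitProj_apply_self`; rank–nullity for the surjective `dπ_y` with
  `dim S = dim M - 1`);
* `IsStationaryKilling.existsUnique_horizontal_lift` — **the horizontal lift**: every tangent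
  vector `ζ` of `S` at `π y` has a unique preimage under `dπ_y` which is `g`-orthogonal to `X y`
  (existence: subtract from any preimage its component along the timelike `X y`; uniqueness: a
  horizontal vector in `ker dπ_y = ℝ·X y` is `g`-orthogonal to itself along a timelike direction,
  hence `0`), i.e. `dπ_y` restricts to a linear isomorphism `𝓗_y = (X y)^⊥ ≅ T_{π y} S`;
* `IsStationaryKilling.val_pos_of_horizontal` — **`g` is positive definite on `𝓗_y`** (the
  orthogonal complement of a timelike vector is spacelike, `LorentzianMetric.pos_of_orthogonal`),
  so that `g|𝓗` is a Euclidean inner product transported by `dπ_y` to `T_{π y} S` — the pointwise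
  datum of Anderson's quotient metric `g_S`;
* the bundled forms `Spacetime.IsStationaryKilling.ker_mfderiv_orbitProj_eq_span`,
  `….existsUnique_horizontal_lift`.

Not here: the invariance of the horizontal inner product along orbits (flow maps are isometries,
`KillingFlowIsometry.lean`) and the smoothness of the resulting section `g_S` on `S`, i.e. `g_S` as a
Riemannian metric on the orbit space. Everything is proved; no definitions, no named facts.

## References

* M. T. Anderson, Ann. Henri Poincaré 1 (2000) 977–994, arXiv:gr-qc/0001091, §0, §1.1 (key
  `Anderson2000`).
* B. O'Neill, *Semi-Riemannian geometry* (1983), Ch. 5, Lemma 5.26 (the orthogonal complement of a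
  timelike vector is spacelike); Ch. 7, Def. 7.44 ff. (semi-Riemannian submersions, vertical and
  horizontal vectors) (key `ONeill1983`).
-/

noncomputable section

open Bundle Set Filter Function Manifold TopologicalSpace
open scoped ContDiff Topology Manifold

namespace Literature.Geometry.Lorentzian

namespace LorentzianMetric

section Horizontal

variable {E : Type*} [NormedAddCommGroup E] [NormedSpace ℝ E] [FiniteDimensional ℝ E]
  [CompleteSpace E] {M : Type*} [TopologicalSpace M] [ChartedSpace E M]
  [IsManifold 𝓘(ℝ, E) ∞ M] [T2Space M]
  {g : LorentzianMetric 𝓘(ℝ, E) ∞ M} [g.HasLeviCivita] {τ : TimeOrientation g}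
  {X : Π x : M, TangentSpace 𝓘(ℝ, E) x} {θ : ℝ × M → M}
  {F : Type*} [NormedAddCommGroup F] [NormedSpace ℝ F] [FiniteDimensional ℝ F]

/-- **The vertical subspace: `ker dπ_y = ℝ·X y`.** For the `C^∞` submersion `π : M → S` onto the
orbit space of a chronological stationary space-time, the kernel of `dπ` at `y` is the line spanned
by the Killing vector `X y` (Anderson 2000, §1.1: "The vertical subspace of `TM` is the subspace
spanned by the Killing field `X`"): `dπ(X y) = 0` (`mfderiv_orbitProj_apply_self`), and by
rank–nullity for the surjective `dπ_y` (`surjective_mfderiv_orbitProj`) the kernel has dimension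
`dim M - dim S = 1`. [cite: Anderson2000, §1.1] -/
theorem IsStationaryKilling.ker_mfderiv_orbitProj_eq_span (h : g.IsStationaryKilling τ X univ)
    (hchr : g.IsChronological τ) (hθ : ContMDiff (𝓘(ℝ, ℝ).prod 𝓘(ℝ, E)) 𝓘(ℝ, E) ∞ θ)
    (hθ0 : ∀ p, θ (0, p) = p) (hθadd : ∀ t s p, θ (t, θ (s, p)) = θ (t + s, p))
    (hθX : ∀ p, IsMIntegralCurve (fun t ↦ θ (t, p)) X)
    (hF : Module.finrank ℝ F + 1 = Module.finrank ℝ E) (y : M) :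
    letI := h.orbitSpaceChartedSpace hchr (hθ.of_le (WithTop.coe_le_coe.mpr le_top)) hθ0 hθadd
      hθX hF
    LinearMap.ker (mfderiv 𝓘(ℝ, E) 𝓘(ℝ, F) (orbitProj X) y).toLinearMap = ℝ ∙ (X y) := by
  letI := h.orbitSpaceChartedSpace hchr (hθ.of_le (WithTop.coe_le_coe.mpr le_top)) hθ0 hθadd
    hθX hF
  haveI : FiniteDimensional ℝ (TangentSpace 𝓘(ℝ, E) y) := ‹FiniteDimensional ℝ E›
  haveI : FiniteDimensional ℝ (TangentSpace 𝓘(ℝ, F) (orbitProj X y)) := ‹FiniteDimensional ℝ F›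
  set L : TangentSpace 𝓘(ℝ, E) y →ₗ[ℝ] TangentSpace 𝓘(ℝ, F) (orbitProj X y) :=
    (mfderiv 𝓘(ℝ, E) 𝓘(ℝ, F) (orbitProj X) y).toLinearMap with hL
  -- `ℝ·X y ≤ ker dπ`
  have hle : (ℝ ∙ (X y)) ≤ LinearMap.ker L := by
    rw [Submodule.span_le, singleton_subset_iff, SetLike.mem_coe, LinearMap.mem_ker]
    exact h.mfderiv_orbitProj_apply_self hchr hθ hθ0 hθadd hθX hF y
  -- dimensions: `dim ker = dim E - dim F = 1 = dim ℝ·X y`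
  have hsurj : Function.Surjective L := h.surjective_mfderiv_orbitProj hchr hθ hθ0 hθadd hθX hF y
  have hrange : LinearMap.range L = ⊤ := LinearMap.range_eq_top.2 hsurj
  have hrn := LinearMap.finrank_range_add_finrank_ker L
  rw [hrange, finrank_top] at hrn
  have hE : Module.finrank ℝ (TangentSpace 𝓘(ℝ, E) y) = Module.finrank ℝ E := rfl
  have hF' : Module.finrank ℝ (TangentSpace 𝓘(ℝ, F) (orbitProj X y)) = Module.finrank ℝ F := rfl
  rw [hE, hF'] at hrn
  have hker : Module.finrank ℝ (LinearMap.ker L) = 1 := by omega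
  have hX0 : X y ≠ 0 := (h.isTimelike (mem_univ y)).1.ne_zero
  have hspan : Module.finrank ℝ (ℝ ∙ (X y)) = 1 := finrank_span_singleton hX0
  exact (Submodule.eq_of_le_of_finrank_eq hle (hspan.trans hker.symm)).symm

/-- **The horizontal lift.** For the submersion `π : M → S` of a chronological stationary
space-time and every tangent vector `ζ` of the orbit space at `π y`, there is a **unique** tangent
vector `v` at `y` which is `g`-orthogonal to the Killing vector `X y` ("horizontal") and projects
to `ζ`: `dπ_y` restricts to a linear isomorphism from the horizontal subspace `𝓗_y = (X y)^⊥` onto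
`T_{π y} S` (Anderson 2000, §0–§1.1: "`g_M` restricted to the horizontal subspaces of `TM`, i.e. the
orthogonal complement of `⟨X⟩ ⊂ TM`"; O'Neill 1983, Ch. 7, Def. 7.44). Existence: from a preimage
`v₀` of `ζ` (`surjective_mfderiv_orbitProj`) subtract its component
`(g(v₀, X)/g(X, X)) X` along the timelike `X y` (which `dπ` kills). Uniqueness: two horizontal lifts
differ by an element of `ker dπ_y = ℝ·X y` orthogonal to `X y`, hence by `0`.
[cite: Anderson2000, §1.1] -/
theorem IsStationaryKilling.existsUnique_horizontal_lift (h : g.IsStationaryKilling τ X univ)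
    (hchr : g.IsChronological τ) (hθ : ContMDiff (𝓘(ℝ, ℝ).prod 𝓘(ℝ, E)) 𝓘(ℝ, E) ∞ θ)
    (hθ0 : ∀ p, θ (0, p) = p) (hθadd : ∀ t s p, θ (t, θ (s, p)) = θ (t + s, p))
    (hθX : ∀ p, IsMIntegralCurve (fun t ↦ θ (t, p)) X)
    (hF : Module.finrank ℝ F + 1 = Module.finrank ℝ E) (y : M) :
    letI := h.orbitSpaceChartedSpace hchr (hθ.of_le (WithTop.coe_le_coe.mpr le_top)) hθ0 hθadd
      hθX hF
    ∀ ζ : TangentSpace 𝓘(ℝ, F) (orbitProj X y), ∃! v : TangentSpace 𝓘(ℝ, E) y,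
      g.val y v (X y) = 0 ∧ mfderiv 𝓘(ℝ, E) 𝓘(ℝ, F) (orbitProj X) y v = ζ := by
  letI := h.orbitSpaceChartedSpace hchr (hθ.of_le (WithTop.coe_le_coe.mpr le_top)) hθ0 hθadd
    hθX hF
  intro ζ
  have hXX : g.val y (X y) (X y) ≠ 0 := (h.isTimelike (mem_univ y)).1.ne
  have hvert : mfderiv 𝓘(ℝ, E) 𝓘(ℝ, F) (orbitProj X) y (X y) = 0 :=
    h.mfderiv_orbitProj_apply_self hchr hθ hθ0 hθadd hθX hF y
  refine ⟨?_, ?_, ?_⟩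
  · -- the horizontal part of a preimage
    exact (Classical.choose (h.surjective_mfderiv_orbitProj hchr hθ hθ0 hθadd hθX hF y ζ)) -
      (g.val y (Classical.choose (h.surjective_mfderiv_orbitProj hchr hθ hθ0 hθadd hθX hF y ζ))
        (X y) / g.val y (X y) (X y)) • X y
  · set v₀ := Classical.choose (h.surjective_mfderiv_orbitProj hchr hθ hθ0 hθadd hθX hF y ζ)
      with hv₀
    have hv₀ζ : mfderiv 𝓘(ℝ, E) 𝓘(ℝ, F) (orbitProj X) y v₀ = ζ :=
      Classical.choose_spec (h.surjective_mfderiv_orbitProj hchr hθ hθ0 hθadd hθX hF y ζ)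
    constructor
    · simp only [map_sub, map_smul, sub_apply, smul_apply,
        smul_eq_mul]
      field_simp
      ring
    · rw [map_sub, map_smul, hvert, smul_zero, sub_zero, hv₀ζ]
  · -- uniqueness
    rintro v ⟨hv, hvζ⟩
    set v₀ := Classical.choose (h.surjective_mfderiv_orbitProj hchr hθ hθ0 hθadd hθX hF y ζ)
      with hv₀
    have hv₀ζ : mfderiv 𝓘(ℝ, E) 𝓘(ℝ, F) (orbitProj X) y v₀ = ζ :=
      Classical.choose_spec (h.surjective_mfderiv_orbitProj hchr hθ hθ0 hθadd hθX hF y ζ)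
    set w : TangentSpace 𝓘(ℝ, E) y := v₀ - (g.val y v₀ (X y) / g.val y (X y) (X y)) • X y with hw
    -- `v - w ∈ ker dπ = ℝ·X y`
    have hker : v - w ∈ LinearMap.ker (mfderiv 𝓘(ℝ, E) 𝓘(ℝ, F) (orbitProj X) y).toLinearMap := by
      rw [LinearMap.mem_ker]
      change mfderiv 𝓘(ℝ, E) 𝓘(ℝ, F) (orbitProj X) y (v - w) = 0
      rw [map_sub, hvζ, hw, map_sub, map_smul, hvert, smul_zero, sub_zero, hv₀ζ, sub_self]
    rw [h.ker_mfderiv_orbitProj_eq_span hchr hθ hθ0 hθadd hθX hF y,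
      Submodule.mem_span_singleton] at hker
    obtain ⟨c, hc⟩ := hker
    -- orthogonality to `X y` forces `c = 0`
    have hw0 : g.val y w (X y) = 0 := by
      simp only [hw, map_sub, map_smul, sub_apply,
        smul_apply, smul_eq_mul]
      field_simp
      ring
    have hc0 : c * g.val y (X y) (X y) = 0 := by
      have := congrArg (fun u ↦ g.val y u (X y)) hc
      simp only [map_smul, smul_apply, smul_eq_mul, map_sub,
        sub_apply, hv, hw0, sub_self] at this
      exact this
    have hc' : c = 0 := (mul_eq_zero.1 hc0).resolve_right hXX
    rw [hc', zero_smul] at hc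
    exact (sub_eq_zero.1 hc.symm)

omit [FiniteDimensional ℝ E] [CompleteSpace E] [T2Space M] [FiniteDimensional ℝ F] in
/-- **`g` is positive definite on horizontal vectors**: a non-zero tangent vector `g`-orthogonal to
the (timelike) stationary Killing vector has `g(v, v) > 0` — the orthogonal complement of a
timelike vector is spacelike (O'Neill 1983, Ch. 5, Lemma 5.26; the signature axiom
`LorentzianMetric.pos_of_orthogonal`). Hence `g|𝓗`, transported to `T S` by the horizontal lift, is
a Euclidean inner product: the pointwise datum of Anderson's Riemannian metric `g_S` (Anderson 2000,
§0). [cite: Anderson2000, §0] -/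
theorem IsStationaryKilling.val_pos_of_horizontal (h : g.IsStationaryKilling τ X univ) {y : M}
    {v : TangentSpace 𝓘(ℝ, E) y} (hv : g.val y v (X y) = 0) (hv0 : v ≠ 0) : 0 < g.val y v v := by
  have hX := (h.isTimelike (mem_univ y)).1
  have hv' : g.val y (X y) v = 0 := by rw [g.symm]; exact hv
  exact g.pos_of_orthogonal y (X y) v hX hv' hv0

end Horizontal

end LorentzianMetric

/-! ### The bundled forms -/

namespace Spacetime

universe u

variable {𝓢 : Spacetime.{u} 4} [𝓢.metric.HasLeviCivita]
  {X : Π x : 𝓢.carrier, TangentSpace (𝓡 4) x}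

/-- `dim ℝ³ + 1 = dim ℝ⁴`. [folklore] -/
private lemma finrank_three_add_one'' :
    Module.finrank ℝ (EuclideanSpace ℝ (Fin 3)) + 1 =
      Module.finrank ℝ (EuclideanSpace ℝ (Fin 4)) := by
  simp [finrank_euclideanSpace]

/-- **Anderson 2000, §1.1, for a bundled spacetime: the vertical subspace is `ker dπ = ℝ·X`.**
[cite: Anderson2000, §1.1] -/
theorem IsStationaryKilling.ker_mfderiv_orbitProj_eq_span (hX : 𝓢.IsStationaryKilling X univ)
    (hchr : 𝓢.metric.IsChronological 𝓢.timeOrientation) (y : 𝓢.carrier) :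
    letI := hX.orbitSpaceChartedSpace hchr
    LinearMap.ker (mfderiv (𝓡 4) (𝓡 3) (orbitProj X) y).toLinearMap = ℝ ∙ (X y) :=
  LorentzianMetric.IsStationaryKilling.ker_mfderiv_orbitProj_eq_span hX hchr hX.contMDiff_flow
    hX.flow_zero hX.flow_add hX.isMIntegralCurve_flow finrank_three_add_one'' y

/-- **Anderson 2000, §0–§1.1, for a bundled spacetime: the horizontal lift** — every tangent
vector of the orbit 3-manifold at `π y` has a unique preimage under `dπ_y` orthogonal to the
stationary Killing vector `X y`. [cite: Anderson2000, §1.1] -/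
theorem IsStationaryKilling.existsUnique_horizontal_lift (hX : 𝓢.IsStationaryKilling X univ)
    (hchr : 𝓢.metric.IsChronological 𝓢.timeOrientation) (y : 𝓢.carrier) :
    letI := hX.orbitSpaceChartedSpace hchr
    ∀ ζ : TangentSpace (𝓡 3) (orbitProj X y), ∃! v : TangentSpace (𝓡 4) y,
      𝓢.metric.val y v (X y) = 0 ∧ mfderiv (𝓡 4) (𝓡 3) (orbitProj X) y v = ζ :=
  LorentzianMetric.IsStationaryKilling.existsUnique_horizontal_lift hX hchr hX.contMDiff_flow
    hX.flow_zero hX.flow_add hX.isMIntegralCurve_flow finrank_three_add_one'' y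

end Spacetime

end Literature.Geometry.Lorentzian

end
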